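import Summits.ResolutionOfSingularities.ResolutionOfSingularities.Theses.ShadowGame
import Summits.ResolutionOfSingularities.ResolutionOfSingularities.Theorems.ShadowGameWin.Negative.Trap

/-!
# Crux `WinToTorsorLU` (stmt-ResolutionOfSingularities-16160), negative side: its only hypothesis
# `ShadowGameWin` is FALSE

`WinToTorsorLU := ShadowGameWin → TorsorLUPerfect` (route `ShadowGame`, crux #3).  Load-bearing
analysis of its single hypothesis: the hypothesis is unsatisfiable, so the crux holds vacuously and
carries no content on the current game (a prover closes item 16160 by
`fun hW => absurd hW not_shadowGameWin`; the dictionary `stub_dictionary` of `Lines/birth.lean`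
must not be staffed before the planner repairs the game).

The proof ASSEMBLES `¬ ShadowGameWin` from the two accepted tree files
`Theorems/ShadowGameWin/Negative/Mirror.lean` (named mirror of the let-bound move generator; the
six states `S0 … S5` of B's trap in `SG_3(2)` over `𝔽₃` from `S0 = v² + u³v + u³v²`; B's policy
`chart`/`tau` and simulation `run`, `iSeq`, `tSeq`) and `…/Negative/Trap.lean` (the six transitions
`step_S0 … step_S5`, `step_singleton`, `not_terminal_of_inCycle`): against EVERY strategy with
non-empty centres, B answers the point centre with chart `u` and the translations `0,0,1,0,0,2`
(advancing the 6-cycle) and any singleton centre is a no-op, so the play — which IS B's simulation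
(`play_eq_run`) — never leaves the cycle (`run_fst_mem_cycle`), B's charts are legal (`chart_mem`),
and no state of the cycle is terminal.  Same proposition as the refutation proposals p151505 /
p151634 of item 16159 (pending at the time of writing); filed here as the antecedent-vacuity lemma
of crux 16160.  Refuter seat refuter-cdisprove-stmt-ResolutionOfSingularities-16160-0, 2026-08-17.
-/

noncomputable section

-- single-problem summit: the doubled namespace component `ResolutionOfSingularities` is forced
set_option linter.dupNamespace false

namespace Summit.ResolutionOfSingularities.ResolutionOfSingularities.Theorems.WinToTorsorLU.Negative

/-- **Record of the dropped route item `ShadowGameWin`** = stmt-ResolutionOfSingularities-16159 (ledger signature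
verbatim; NOT a route item): route `ShadowGame` rev 3 (2026-08-17T13:32Z) restated the refuted crux `ShadowGameWin`
(closed·refuted by `Theorems.ShadowGameShadowGameWin_refuted`) as `ShadowGameWinR` and removed the old name, so the
former line `open …Theses.ShadowGame (ShadowGameWin)` here and the statements of `not_shadowGameWin` /
`shadowGameWin_elim` below stopped elaborating, and with them the importer
`Theorems/WinToTorsorLUR/Negative/FormalClauseLoadBearing.lean` (the CURRENT route's `…_false_without_formalClause`
lemma, which uses only `chart_mem` / `run_fst_mem_cycle` / `play_eq_run` from this file) stopped building (buildfix
lane 2026-08-19/20).  Re-created HERE in this file's own namespace (namespace resolution needs no `open`; the statement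
texts below are unchanged and now denote this record).  It is NOT re-created under the route namespace (route decls are
the planners'; a route-namespace record is left to the operator's maintenance batch for the two sibling modules that
spell the full name).  Body copied byte-for-byte from the rev-2 route file / the ledger signature of stmt-16159. -/
def ShadowGameWin : Prop :=
  ∀ p : ℕ, p.Prime → ∀ n : ℕ, 0 < n → ∃ strat : List (Set (Fin n → ℚ)) → List (Fin n) → Finset (Fin n), (∀ hs js, (strat hs js).Nonempty) ∧ ∀ (κ : Type) [Field κ] [CharP κ p] [PerfectField κ] (c₀ : (Fin n → ℕ) → κ) (i : ℕ → Fin n) (t : ℕ → Fin n → κ), let clean : ((Fin n → ℕ) → κ) → ((Fin n → ℕ) → κ) := fun c A => @ite κ (∀ j, p ∣ A j) (Classical.dec _) 0 (c A); let bl : Finset (Fin n) → Fin n → ((Fin n → ℕ) → κ) → ((Fin n → ℕ) → κ) := fun F i c B => @ite κ (Finset.sum (F.erase i) (fun j => B j) ≤ B i) (Classical.dec _) (c (Function.update B i (B i - Finset.sum (F.erase i) (fun j => B j)))) 0; let mF : Finset (Fin n) → ((Fin n → ℕ) → κ) → ℕ := fun F c => sInf {m : ℕ | ∃ A, c A ≠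 0 ∧ m = Finset.sum F (fun j => A j)}; let dv : Fin n → ℕ → ((Fin n → ℕ) → κ) → ((Fin n → ℕ) → κ) := fun i s c B => c (Function.update B i (B i + s)); let tr : Finset (Fin n) → Fin n → (Fin n → κ) → ℕ → ((Fin n → ℕ) → κ) → ((Fin n → ℕ) → κ) := fun F i τ s c B => Finset.sum (Fintype.piFinset (fun _ : Fin n => Finset.range (B i + s + 1))) (fun D => @ite κ (∀ j, j ∉ F.erase i → D j = 0) (Classical.dec _) (c (B + D) * Finset.prod (F.erase i) (fun j => ((Nat.choose (B j + D j) (B j) : ℕ) : κ) * τ j ^ (D j))) 0); let step : Finset (Fin n) → Fin n → (Fin n → κ) → ((Fin n → ℕ) → κ) → ((Fin n → ℕ) → κ) := fun F i τ c => clean (tr F i τ (p * (mF F (clean c) / p)) (dv i (p * (mF F (clean c) / p)) (bl F i (clean c)))); let shadow : ((Fin n → ℕ) → κ) → Set (Fin n → ℚ) := fun c => convexHull ℚ {x : Fin n → ℚ | ∃ A, clean c A ≠ 0 ∧ ∀ j, ((A j : ℚ) / p) ≤ x j}; let Terminal : ((Fin n → ℕ) → κ) → Prop := fun c => (∀ A,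 clean c A = 0) ∨ ∃ A, clean c A ≠ 0 ∧ (Finset.sum Finset.univ (fun j => A j) ≤ 1 ∨ ∀ B, clean c B ≠ 0 → ∀ j, A j ≤ B j); let play : ℕ → (((Fin n → ℕ) → κ) × List (Set (Fin n → ℚ)) × List (Fin n)) := fun m => @Nat.rec (fun _ => ((Fin n → ℕ) → κ) × List (Set (Fin n → ℚ)) × List (Fin n)) (c₀, [shadow c₀], ([] : List (Fin n))) (fun m st => (step (strat st.2.1 st.2.2) (i m) (t m) st.1, st.2.1 ++ [shadow (step (strat st.2.1 st.2.2) (i m) (t m) st.1)], st.2.2 ++ [i m])) m; (∀ m, i m ∈ strat (play m).2.1 (play m).2.2) → ∃ m, Terminal (play m).1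
open Summit.ResolutionOfSingularities.ResolutionOfSingularities.Theorems.ShadowGameWin.Negative

/-- The subsets of `Fin 2`. [folklore] -/
theorem finset_fin_two_cases (F : Finset (Fin 2)) :
    F = ∅ ∨ F = {0} ∨ F = {1} ∨ F = {0, 1} := by
  by_cases h0 : (0 : Fin 2) ∈ F <;> by_cases h1 : (1 : Fin 2) ∈ F
  · right; right; right; ext j; fin_cases j <;> simp [h0, h1]
  · right; left; ext j; fin_cases j <;> simp [h0, h1]
  · right; right; left; ext j; fin_cases j <;> simp [h0, h1]
  · left; ext j; fin_cases j <;> simp [h0, h1]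

/-- B's chart is legal: `chart F ∈ F` whenever `F` is non-empty. [folklore] -/
theorem chart_mem {F : Finset (Fin 2)} (hF : F.Nonempty) : chart F ∈ F := by
  unfold chart
  split_ifs with h
  · exact h
  · rcases finset_fin_two_cases F with rfl | rfl | rfl | rfl
    · exact absurd hF (Finset.not_nonempty_empty)
    · exact absurd (Finset.mem_singleton_self 0) h
    · exact Finset.mem_singleton_self 1
    · exact absurd (by simp) h

/-- B's chart on the point centre is `u`. [folklore] -/
theorem chart_pair : chart ({0, 1} : Finset (Fin 2)) = 0 := by
  unfold chart; rw [if_pos (by simp)]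

/-- B's chart on the centre `{u}` is `u`. [folklore] -/
theorem chart_zero : chart ({0} : Finset (Fin 2)) = 0 := by
  unfold chart; rw [if_pos (by simp)]

/-- B's chart on the centre `{v}` is `v`. [folklore] -/
theorem chart_one : chart ({1} : Finset (Fin 2)) = 1 := by
  unfold chart; rw [if_neg (by simp)]

/-- `S0 ≠ S2` (they differ at the exponent `(0,2)`). [folklore] -/
theorem S0_ne_S2 : S0 ≠ S2 := fun h => absurd (congrFun h ![0, 2]) (by decide)
/-- `S0 ≠ S5`. [folklore] -/
theorem S0_ne_S5 : S0 ≠ S5 := fun h => absurd (congrFun h ![0, 2]) (by decide)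
/-- `S1 ≠ S2`. [folklore] -/
theorem S1_ne_S2 : S1 ≠ S2 := fun h => absurd (congrFun h ![2, 2]) (by decide)
/-- `S1 ≠ S5`. [folklore] -/
theorem S1_ne_S5 : S1 ≠ S5 := fun h => absurd (congrFun h ![2, 2]) (by decide)
/-- `S3 ≠ S2`. [folklore] -/
theorem S3_ne_S2 : S3 ≠ S2 := fun h => absurd (congrFun h ![0, 2]) (by decide)
/-- `S3 ≠ S5`. [folklore] -/
theorem S3_ne_S5 : S3 ≠ S5 := fun h => absurd (congrFun h ![0, 2]) (by decide)
/-- `S4 ≠ S2`. [folklore] -/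
theorem S4_ne_S2 : S4 ≠ S2 := fun h => absurd (congrFun h ![2, 2]) (by decide)
/-- `S4 ≠ S5`. [folklore] -/
theorem S4_ne_S5 : S4 ≠ S5 := fun h => absurd (congrFun h ![2, 2]) (by decide)
/-- `S5 ≠ S2` (they differ at `(2,1)`: coefficients `2` and `1`). [folklore] -/
theorem S5_ne_S2 : S5 ≠ S2 := fun h => absurd (congrFun h ![2, 1]) (by decide)

/-- B's translation at `S0` is `0`. [folklore] -/
theorem tau_S0 : tau S0 = fun _ => 0 := by unfold tau; rw [if_neg S0_ne_S2, if_neg S0_ne_S5]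
/-- B's translation at `S1` is `0`. [folklore] -/
theorem tau_S1 : tau S1 = fun _ => 0 := by unfold tau; rw [if_neg S1_ne_S2, if_neg S1_ne_S5]
/-- B's translation at `S2` is `1`. [folklore] -/
theorem tau_S2 : tau S2 = fun _ => 1 := by unfold tau; rw [if_pos rfl]
/-- B's translation at `S3` is `0`. [folklore] -/
theorem tau_S3 : tau S3 = fun _ => 0 := by unfold tau; rw [if_neg S3_ne_S2, if_neg S3_ne_S5]
/-- B's translation at `S4` is `0`. [folklore] -/
theorem tau_S4 : tau S4 = fun _ => 0 := by unfold tau; rw [if_neg S4_ne_S2, if_neg S4_ne_S5]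
/-- B's translation at `S5` is `2`. [folklore] -/
theorem tau_S5 : tau S5 = fun _ => 2 := by unfold tau; rw [if_neg S5_ne_S2, if_pos rfl]

/-- ONE MOVE OF THE TRAP: from a state of the cycle, whatever non-empty centre A names, B's answer
(chart `u` if allowed, the prescribed translation) leads back into the cycle — the point centre
advances the cycle (`step_S0 … step_S5`), a singleton centre is a no-op (`step_singleton`).
[folklore] -/
theorem step_mem_cycle {c : (Fin 2 → ℕ) → ZMod 3} (hc : c ∈ cycle) {F : Finset (Fin 2)}
    (hF : F.Nonempty) : step 3 F (chart F) (tau c) c ∈ cycle := by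
  rcases finset_fin_two_cases F with rfl | rfl | rfl | rfl
  · exact absurd hF Finset.not_nonempty_empty
  · rw [chart_zero, step_singleton 0 _ c (clean_of_inCycle hc) (mF0_lt hc)]; exact hc
  · rw [chart_one, step_singleton 1 _ c (clean_of_inCycle hc) (mF1_lt hc)]; exact hc
  · rw [chart_pair]
    rcases (mem_cycle_iff c).mp hc with rfl | rfl | rfl | rfl | rfl | rfl
    · rw [tau_S0, step_S0]; exact (mem_cycle_iff _).mpr (by simp)
    · rw [tau_S1, step_S1]; exact (mem_cycle_iff _).mpr (by simp)
    · rw [tau_S2, step_S2]; exact (mem_cycle_iff _).mpr (by simp)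
    · rw [tau_S3, step_S3]; exact (mem_cycle_iff _).mpr (by simp)
    · rw [tau_S4, step_S4]; exact (mem_cycle_iff _).mpr (by simp)
    · rw [tau_S5, step_S5]; exact (mem_cycle_iff _).mpr (by simp)

/-- B's simulated play never leaves the cycle, against EVERY strategy with non-empty centres.
[folklore] -/
theorem run_fst_mem_cycle (strat : List (Set (Fin 2 → ℚ)) → List (Fin 2) → Finset (Fin 2))
    (hne : ∀ hs js, (strat hs js).Nonempty) : ∀ m, (run strat m).1 ∈ cycle
  | 0 => (mem_cycle_iff _).mpr (Or.inl rfl)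
  | m + 1 => by
    show step 3 (strat (run strat m).2.1 (run strat m).2.2)
        (chart (strat (run strat m).2.1 (run strat m).2.2)) (tau (run strat m).1) (run strat m).1 ∈ cycle
    exact step_mem_cycle (run_fst_mem_cycle strat hne m) (hne _ _)

/-- The actual play of the game from `S0` against B's sequences `iSeq / tSeq` IS B's simulation.
[folklore] -/
theorem play_eq_run (strat : List (Set (Fin 2 → ℚ)) → List (Fin 2) → Finset (Fin 2)) :
    ∀ m, play 3 strat S0 (iSeq strat) (tSeq strat) m = run strat m
  | 0 => rfl
  | m + 1 => by
    rw [play_succ, play_eq_run strat m]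
    rfl

/-- **The hypothesis of crux `WinToTorsorLU` is false**: B wins `SG_3(2)` over `𝔽₃` from
`v² + u³v + u³v²` against every strategy of A, so `ShadowGameWin` fails at `(p, n) = (3, 2)`.
(The route decl's `let`-block is definitionally the mirrored statement: the `have h : … := hwin …`
below is accepted by `rfl`-conversion.) [folklore] -/
theorem not_shadowGameWin : ¬ ShadowGameWin := by
  intro hW
  obtain ⟨strat, hne, hwin⟩ := hW 3 (by norm_num) 2 (by norm_num)
  haveI : PerfectField (ZMod 3) := PerfectField.ofFinite
  have h : (∀ m, iSeq strat m ∈ strat (play 3 strat S0 (iSeq strat) (tSeq strat) m).2.1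
      (play 3 strat S0 (iSeq strat) (tSeq strat) m).2.2) →
      ∃ m, ((∀ A, clean 3 (play 3 strat S0 (iSeq strat) (tSeq strat) m).1 A = 0) ∨
        ∃ A, clean 3 (play 3 strat S0 (iSeq strat) (tSeq strat) m).1 A ≠ 0 ∧
          (Finset.sum Finset.univ (fun j => A j) ≤ 1 ∨
            ∀ B, clean 3 (play 3 strat S0 (iSeq strat) (tSeq strat) m).1 B ≠ 0 →
              ∀ j, A j ≤ B j)) :=
    hwin (ZMod 3) S0 (iSeq strat) (tSeq strat)
  obtain ⟨m, hm⟩ := h (fun m => by rw [play_eq_run strat m]; exact chart_mem (hne _ _))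
  rw [play_eq_run strat m] at hm
  exact not_terminal_of_inCycle (run_fst_mem_cycle strat hne m) hm

/-- Restatement for importers: EVERY implication out of `ShadowGameWin` holds (in particular the
crux `WinToTorsorLU` and `Lines/birth.lean`'s `Sig.stub_dictionary`), i.e. the hypothesis carries
no information. [folklore] -/
theorem shadowGameWin_elim (Q : Prop) (hW : ShadowGameWin) : Q := absurd hW not_shadowGameWin

end Summit.ResolutionOfSingularities.ResolutionOfSingularities.Theorems.WinToTorsorLU.Negative

end
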